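import Summits.ValiantsHypothesis.ValiantsHypothesis.Theorems.KPlusLogSqLawTropicalBSplitDefs

/-!
# Route `KPlusLogSqLaw`, crux `TropicalB` — RELABELING rows and columns of a design

HONEST FRAMING.  Helper file toward the registered stubs `stub_tropThin` / `stub_tropFat` of
`Cruxes/TropicalB/Lines/birth.lean` (crux `Summit.ValiantsHypothesis.ValiantsHypothesis.Theses.KPlusLogSqLaw.TropicalB`,
ledger item `stmt-ValiantsHypothesis-19771`, route `KPlusLogSqLaw`, DRAFT; cell `pub-symmetroid`, seat `val-sym-trop-p1`,
2026-08-26).  Nothing here proves any part of a stub; nothing asserts `TropicalB`, `KPlusLogSqLaw`, `MatrixDescartes`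
or anything about `VP ≠ VNP`.

Permuting the rows by `π` and the columns by `ρ` of a tropical design — `v' a b l = v (π a) (ρ b) l`,
`ε' a b l = ε (π a) (ρ b) l`, same exponents `d` — does not change its dominant chains: the Leibniz term `(σ, λ)` of the
relabeled design corresponds to the term `(π σ ρ⁻¹, λ ∘ ρ⁻¹)` of the original one, with the same weight at every slope,
the same presence, and the sign multiplied by the constant `sign π · sign ρ` (so sign ALTERNATION is preserved too).
Hence the unsigned row bound `DesignRowD` (companion definitions file) is invariant:

* `tropWeight_relabel`, `termSign_relabel`, `isDominant_relabel_iff`;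
* `designRowD_relabel : DesignRowD d v ε B → DesignRowD d v' ε' B` and `designRowD_of_relabel` (converse);
* `alternating_relabel_iff` (sign alternation of consecutive terms is preserved).

Use: support classes defined up to relabeling (e.g. designs that are Hessenberg after a cyclic shift of the columns —
the walk matrices `I − A − u vᵀ` of the tree's staircase families) inherit the bounds proved for the class. [folklore]
-/

set_option linter.dupNamespace false
set_option autoImplicit false

namespace Summit.ValiantsHypothesis.ValiantsHypothesis.Theorems.KPlusLogSqLaw

open Summit.ValiantsHypothesis.ValiantsHypothesis.Theorems.MatrixDescartes.Negative
open Summit.ValiantsHypothesis.ValiantsHypothesis.Theorems.LacunarySymmetroidMatrixDescartes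
open Summit.ValiantsHypothesis.ValiantsHypothesis.Theorems.LacunarySymmetroidMatrixDescartes.TropicalCensus
open scoped BigOperators
open Finset

section Relabel

variable {m K : ℕ} (d : Fin K → ℕ) (v ε : Fin m → Fin m → Fin K → ℤ) (π ρ : Equiv.Perm (Fin m))

/-- **Weight is invariant under relabeling**: the term `(π σ ρ⁻¹, λ ∘ ρ⁻¹)` of the original design has the weight of
`(σ, λ)` in the relabeled design `v' a b l = v (π a) (ρ b) l`. [folklore] -/
theorem tropWeight_relabel (q : Equiv.Perm (Fin m) × (Fin m → Fin K)) (θ : ℤ) :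
    tropWeight d v θ (π * q.1 * ρ⁻¹, fun j => q.2 (ρ⁻¹ j)) =
      tropWeight d (fun a b l => v (π a) (ρ b) l) θ q := by
  unfold tropWeight
  simp only
  have e1 : ∑ j, (d (q.2 (ρ⁻¹ j)) : ℤ) = ∑ i, (d (q.2 i) : ℤ) :=
    Fintype.sum_equiv ρ⁻¹ _ _ (fun _ => rfl)
  have e2 : ∑ j, v ((π * q.1 * ρ⁻¹) j) j (q.2 (ρ⁻¹ j)) = ∑ i, v (π (q.1 i)) (ρ i) (q.2 i) := by
    refine Fintype.sum_equiv ρ⁻¹ _ _ (fun j => ?_)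
    simp only [Equiv.Perm.mul_apply]
    congr 1
    simp
  rw [e1, e2]

/-- **Sign under relabeling**: `termSign ε (π σ ρ⁻¹, λ ∘ ρ⁻¹) = sign π · sign ρ · termSign ε' (σ, λ)`. [folklore] -/
theorem termSign_relabel (q : Equiv.Perm (Fin m) × (Fin m → Fin K)) :
    termSign ε (π * q.1 * ρ⁻¹, fun j => q.2 (ρ⁻¹ j)) =
      (Equiv.Perm.sign π : ℤ) * (Equiv.Perm.sign ρ : ℤ) * termSign (fun a b l => ε (π a) (ρ b) l) q := by
  unfold termSign
  simp only
  have e2 : ∏ j, ε ((π * q.1 * ρ⁻¹) j) j (q.2 (ρ⁻¹ j)) = ∏ i, ε (π (q.1 i)) (ρ i) (q.2 i) := by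
    refine Fintype.prod_equiv ρ⁻¹ _ _ (fun j => ?_)
    simp only [Equiv.Perm.mul_apply]
    congr 1
    simp
  rw [e2, Equiv.Perm.sign_mul, Equiv.Perm.sign_mul, Equiv.Perm.sign_inv]
  push_cast
  ring

/-- presence is invariant under relabeling. [folklore] -/
theorem termSign_relabel_ne_zero_iff (q : Equiv.Perm (Fin m) × (Fin m → Fin K)) :
    termSign ε (π * q.1 * ρ⁻¹, fun j => q.2 (ρ⁻¹ j)) ≠ 0 ↔
      termSign (fun a b l => ε (π a) (ρ b) l) q ≠ 0 := by
  rw [termSign_relabel]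
  have hπ : ((Equiv.Perm.sign π : ℤˣ) : ℤ) ≠ 0 := (Equiv.Perm.sign π).ne_zero
  have hρ : ((Equiv.Perm.sign ρ : ℤˣ) : ℤ) ≠ 0 := (Equiv.Perm.sign ρ).ne_zero
  rw [mul_ne_zero_iff, mul_ne_zero_iff]
  tauto

/-- the term transport `(σ, λ) ↦ (π σ ρ⁻¹, λ ∘ ρ⁻¹)` is injective. [folklore] -/
theorem relabelTerm_injective :
    Function.Injective fun q : Equiv.Perm (Fin m) × (Fin m → Fin K) =>
      ((π * q.1 * ρ⁻¹ : Equiv.Perm (Fin m)), fun j => q.2 (ρ⁻¹ j)) := by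
  intro q q' h
  simp only [Prod.mk.injEq] at h
  obtain ⟨h1, h2⟩ := h
  refine Prod.ext ?_ (funext fun i => ?_)
  · have := congrArg (fun τ => π⁻¹ * τ * ρ) h1
    simpa [mul_assoc] using this
  · have := congrFun h2 (ρ i)
    simpa using this

/-- the term transport is surjective: `qh = (π σ ρ⁻¹, λ ∘ ρ⁻¹)` for `σ = π⁻¹ qh.1 ρ`, `λ = qh.2 ∘ ρ`. [folklore] -/
theorem relabelTerm_surjective (q' : Equiv.Perm (Fin m) × (Fin m → Fin K)) :
    ∃ q : Equiv.Perm (Fin m) × (Fin m → Fin K),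
      ((π * q.1 * ρ⁻¹ : Equiv.Perm (Fin m)), fun j => q.2 (ρ⁻¹ j)) = q' := by
  refine ⟨(π⁻¹ * q'.1 * ρ, fun i => q'.2 (ρ i)), Prod.ext ?_ (funext fun j => ?_)⟩
  · simp [mul_assoc]
  · simp

/-- **Dominance is invariant under relabeling.** [folklore] -/
theorem isDominant_relabel_iff (q : Equiv.Perm (Fin m) × (Fin m → Fin K)) (θ : ℤ) :
    IsDominant d v ε θ (π * q.1 * ρ⁻¹, fun j => q.2 (ρ⁻¹ j)) ↔
      IsDominant d (fun a b l => v (π a) (ρ b) l) (fun a b l => ε (π a) (ρ b) l) θ q := by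
  constructor
  · rintro ⟨hpres, hdom⟩
    refine ⟨(termSign_relabel_ne_zero_iff ε π ρ q).mp hpres, fun q' hq' hq's => ?_⟩
    have hne : ((π * q'.1 * ρ⁻¹ : Equiv.Perm (Fin m)), fun j => q'.2 (ρ⁻¹ j)) ≠
        ((π * q.1 * ρ⁻¹ : Equiv.Perm (Fin m)), fun j => q.2 (ρ⁻¹ j)) :=
      fun h => hq' (relabelTerm_injective π ρ h)
    have h := hdom _ hne ((termSign_relabel_ne_zero_iff ε π ρ q').mpr hq's)
    rwa [tropWeight_relabel, tropWeight_relabel] at h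
  · rintro ⟨hpres, hdom⟩
    refine ⟨(termSign_relabel_ne_zero_iff ε π ρ q).mpr hpres, fun qh hqh hqhs => ?_⟩
    obtain ⟨q', rfl⟩ := relabelTerm_surjective π ρ qh
    have hne : q' ≠ q := fun h => hqh (by rw [h])
    have h := hdom q' hne ((termSign_relabel_ne_zero_iff ε π ρ q').mp hqhs)
    rwa [← tropWeight_relabel d v π ρ q', ← tropWeight_relabel d v π ρ q] at h

/-- **The unsigned row bound is invariant under relabeling** (from the original design to the relabeled one).
[folklore] -/
theorem designRowD_relabel {B : ℕ} (h : DesignRowD d v ε B) :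
    DesignRowD d (fun a b l => v (π a) (ρ b) l) (fun a b l => ε (π a) (ρ b) l) B := by
  intro n θ p hθ hdom hne
  refine h n θ (fun k => ((π * (p k).1 * ρ⁻¹ : Equiv.Perm (Fin m)), fun j => (p k).2 (ρ⁻¹ j))) hθ
    (fun k => (isDominant_relabel_iff d v ε π ρ (p k) (θ k)).mpr (hdom k)) (fun k hk => hne k ?_)
  exact relabelTerm_injective π ρ hk

/-- relabeling twice by inverse permutations gives back the design (valuations). [folklore] -/
theorem relabel_relabel_inv (w : Fin m → Fin m → Fin K → ℤ) :
    (fun a b l => (fun a' b' l' => w (π a') (ρ b') l') (π⁻¹ a) (ρ⁻¹ b) l) = w := by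
  funext a b l
  simp

/-- **Converse**: a bound for the relabeled design is a bound for the original one. [folklore] -/
theorem designRowD_of_relabel {B : ℕ}
    (h : DesignRowD d (fun a b l => v (π a) (ρ b) l) (fun a b l => ε (π a) (ρ b) l) B) :
    DesignRowD d v ε B := by
  have h' := designRowD_relabel d _ _ π⁻¹ ρ⁻¹ h
  rwa [relabel_relabel_inv π ρ v, relabel_relabel_inv π ρ ε] at h'

/-- **Sign alternation is invariant under relabeling** (the signs of all terms are multiplied by the same unit
`sign π · sign ρ`). [folklore] -/
theorem alternating_relabel_iff (q q' : Equiv.Perm (Fin m) × (Fin m → Fin K)) :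
    termSign ε (π * q.1 * ρ⁻¹, fun j => q.2 (ρ⁻¹ j)) * termSign ε (π * q'.1 * ρ⁻¹, fun j => q'.2 (ρ⁻¹ j)) < 0 ↔
      termSign (fun a b l => ε (π a) (ρ b) l) q * termSign (fun a b l => ε (π a) (ρ b) l) q' < 0 := by
  rw [termSign_relabel, termSign_relabel]
  set s := ((Equiv.Perm.sign π : ℤˣ) : ℤ) * ((Equiv.Perm.sign ρ : ℤˣ) : ℤ) with hs
  have hs1 : s * s = 1 := by
    rcases Int.units_eq_one_or (Equiv.Perm.sign π) with h | h <;>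
      rcases Int.units_eq_one_or (Equiv.Perm.sign ρ) with h' | h' <;> simp [hs, h, h']
  set a := termSign (fun a b l => ε (π a) (ρ b) l) q
  set b := termSign (fun a b l => ε (π a) (ρ b) l) q'
  have e : s * a * (s * b) = a * b := by linear_combination (a * b) * hs1
  rw [e]

/-- **Signed chains transport under relabeling**: a sign-alternating dominant chain of the relabeled design gives one of
the original design with the same slopes and length. [folklore] -/
theorem signedChain_relabel {n : ℕ} (θ : Fin (n + 1) → ℤ) (p : Fin (n + 1) → Equiv.Perm (Fin m) × (Fin m → Fin K))
    (hdom : ∀ k, IsDominant d (fun a b l => v (π a) (ρ b) l) (fun a b l => ε (π a) (ρ b) l) (θ k) (p k))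
    (halt : ∀ k : Fin n, termSign (fun a b l => ε (π a) (ρ b) l) (p k.castSucc) *
      termSign (fun a b l => ε (π a) (ρ b) l) (p k.succ) < 0) :
    (∀ k, IsDominant d v ε (θ k) ((π * (p k).1 * ρ⁻¹ : Equiv.Perm (Fin m)), fun j => (p k).2 (ρ⁻¹ j))) ∧
    (∀ k : Fin n, termSign ε ((π * (p k.castSucc).1 * ρ⁻¹ : Equiv.Perm (Fin m)), fun j => (p k.castSucc).2 (ρ⁻¹ j)) *
      termSign ε ((π * (p k.succ).1 * ρ⁻¹ : Equiv.Perm (Fin m)), fun j => (p k.succ).2 (ρ⁻¹ j)) < 0) :=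
  ⟨fun k => (isDominant_relabel_iff d v ε π ρ (p k) (θ k)).mpr (hdom k),
    fun k => (alternating_relabel_iff ε π ρ (p k.castSucc) (p k.succ)).mpr (halt k)⟩

end Relabel

end Summit.ValiantsHypothesis.ValiantsHypothesis.Theorems.KPlusLogSqLaw
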